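import Literature.IUT.HodgeTheaters.TemperedCoveringsCharts
import Literature.AnabelianGeometry.SemiGraphs.TemperedCompactInVerticialAt
import HarnessLib

/-!
# [IUTchI] Prop. 2.1 / Prop. 2.2 on a tempered fundamental group CHART, with [SemiAnbd] Thm 3.7 (iii) AT THE ONE GRAPH `𝒢`

Mochizuki, *Inter-universal Teichmüller theory I*, kurims manuscript (May 2020), §2, Proposition 2.1
and Proposition 2.2, p. 45 [cite: Mochizuki2012, Prop 2.1 p.45] (D-0012 claim key; series status
DISPUTED; nothing of the series is asserted here).

PROOF-ONLY companion (abc-iut cell, φ2-consumers programme of L3-lead rulings α4-3/α6-1, L5 block «φ2-L5»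
item L5a, seat abc-iut-L3-d1) of `TemperedCoveringsCharts.lean` (abc-iut-L5-t11): the SAME proofs of
`conj_le_of_compactInVerticial`, `prop21_of_chart`, `tp_isCommensurablyTerminal_of_chart`, with the
∀-countable named fact `ProfiniteSemiGraph.CompactInVerticial` ([SemiAnbd] Thm 3.7 (iii) for EVERY
countable `𝒢`, FACT-LIST F-1732) replaced by its per-graph form `ProfiniteSemiGraph.CompactInVerticialAt 𝒢`
(`TemperedCompactInVerticialAt.lean`, abc-iut-w4-d075: the body of the frozen fact at one graph,
`compactInVerticial_iff_forall_at : CompactInVerticial ↔ ∀ 𝒢, CompactInVerticialAt 𝒢 := Iff.rfl`) at the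
ONE graph `𝒢` where each proof instantiates it — the dual semi-graph of a pointed stable curve is FINITE,
which is exactly the scope of print's proof of Thm 3.7 (iii) ([SemiAnbd] p. 41 "since the semi-graphs
`𝔾_j` are all finite") and of the cell's finite-`𝔾` producer (`compactInVerticialAt_of_finiteLevelData`).
Port rule: `(hCV : CompactInVerticial)` ↦ `(hCV : CompactInVerticialAt 𝒢)`, `hCV 𝒢 h𝒢 … ↦ hCV h𝒢 …`,
decl suffix `_at`; everything else verbatim; the original is untouched (its fact-free lemmas
`isTempered_tp_of_chart`, `exists_verticial_family_of_chart`, `exists_infinite_compact_of_chart` are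
reused by name).  Typed ≠ proved; nothing here bears on [IUTchIII] Cor. 3.12.
-/

namespace Literature.IUT.HodgeTheaters

open Pointwise Filter
open _root_.Topology
open Literature.AnabelianGeometry.SemiGraphs (IsTempered ProfiniteSemiGraph)
open Literature.AnabelianGeometry.SemiGraphs.ProfiniteSemiGraph (TemperedPiChart verticialSubgroups
  CompactInVerticialAt VerticialInjective IsVerticialHom isCompact_of_mem_verticialSubgroups
  exists_conj_of_mem_verticialSubgroups)
open Literature.AnabelianGeometry.AbsoluteAnabelian (IsCommensurablyTerminal)

universe u

namespace TemperedGraphGroupData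

variable (D : TemperedGraphGroupData.{u}) {𝒢 : ProfiniteSemiGraph.{u}}

/-- **(A1) BY NAME, from [SemiAnbd] Thm 3.7 (iii) AT `𝒢`** (`CompactInVerticialAt 𝒢`) together with
"the verticial subgroups at `v` are the conjugates of any one of them"
(`exists_conj_of_mem_verticialSubgroups`): every compact `Λ ⊆ Π^tp_𝔾` lies in `t·Λ_v·t⁻¹` for some
vertex `v` and `t ∈ Π^tp_𝔾` ([IUTchI] p. 45: "it follows from [SemiAnbd] Thm 3.7 (iii) that `Λ`,
`γ·Λ·γ⁻¹` are contained in verticial subgroups") — φ2 twin of `conj_le_of_compactInVerticial`.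
[cite: Mochizuki2012, Prop 2.1 p.45] -/
theorem conj_le_of_compactInVerticial_at (c : TemperedPiChart 𝒢) (e : D.Tp ≃ₜ* c.G)
    (h𝒢 : 𝒢.Thm37Hypotheses) (hCV : CompactInVerticialAt 𝒢)
    (Λv : 𝒢.graph.Vertex → Subgroup D.Tp)
    (hΛv : ∀ v, (Λv v).map (e : D.Tp →* c.G) ∈ verticialSubgroups c v)
    (Λ : Subgroup D.Tp) (hΛc : IsCompact (Λ : Set D.Tp)) :
    ∃ (v : 𝒢.graph.Vertex) (t : D.Tp), Λ ≤ MulAut.conj t • Λv v := by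
  have hc' : IsCompact ((Λ.map (e : D.Tp →* c.G) : Subgroup c.G) : Set c.G) := by
    rw [Subgroup.coe_map]
    exact hΛc.image e.continuous
  obtain ⟨⟨v, H, hH, hle⟩, -⟩ := hCV h𝒢 c _ hc'
  obtain ⟨g, hg⟩ := exists_conj_of_mem_verticialSubgroups c (hΛv v) hH
  refine ⟨v, e.symm g, fun l hl => ?_⟩
  have hl' : (e : D.Tp →* c.G) l ∈ H := hle (Subgroup.mem_map_of_mem _ hl)
  rw [hg, Subgroup.mem_map] at hl'
  obtain ⟨y, hy, hyl⟩ := hl'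
  obtain ⟨m, hm, rfl⟩ := Subgroup.mem_map.mp hy
  refine (Subgroup.mem_smul_pointwise_iff_exists l (MulAut.conj (e.symm g)) (Λv v)).mpr
    ⟨m, hm, e.injective ?_⟩
  simp only [MulEquiv.coe_toMonoidHom, MulAut.conj_apply, MonoidHom.coe_coe] at hyl
  rw [MulAut.smul_def, MulAut.conj_apply, map_mul, map_mul, map_inv, ← hyl]
  simp

/-- **[IUTchI] Proposition 2.1 for `D` with `Π^tp_𝔾` a tempered fundamental group chart of `𝒢`, the
[SemiAnbd] inputs BY NAME with Thm 3.7 (iii) AT `𝒢`** (`CompactInVerticialAt 𝒢`); remaining hypotheses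
exactly as in the original `prop21_of_chart` (Hausdorffness of `Π̂_𝔾`, (RF), the node data of the
universal pro-covering in coset coordinates, (A3)). φ2 twin of `prop21_of_chart`.
([IUTchI] Prop 2.1 p.45) [claim: Mochizuki2012, status: disputed] -/
theorem prop21_of_chart_at [T2Space D.Hat] (c : TemperedPiChart 𝒢) (e : D.Tp ≃ₜ* c.G)
    (h𝒢 : 𝒢.Thm37Hypotheses) (hCV : CompactInVerticialAt 𝒢)
    (Λv : 𝒢.graph.Vertex → Subgroup D.Tp)
    (hΛv : ∀ v, (Λv v).map (e : D.Tp →* c.G) ∈ verticialSubgroups c v)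
    (hRF : ∀ U ∈ 𝓝 (1 : D.Tp), ∃ N : OpenNormalSubgroup D.Tp, (N : Set D.Tp) ⊆ U ∧
      ((N.toSubgroup.map D.ι).topologicalClosure).comap D.ι ≤ N.toSubgroup)
    {E : Type*} (src tgt : E → 𝒢.graph.Vertex) (c₁ c₂ : E → D.Tp)
    (hA3 : ∀ (v w : 𝒢.graph.Vertex) (g h : D.Hat),
      MulAut.conj g • (Λv v).map D.ι ⊓ MulAut.conj h • (Λv w).map D.ι ≠ ⊥ →
        (v = w ∧ g⁻¹ * h ∈ (Λv v).map D.ι) ∨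
        ∃ (e : E) (k : D.Hat), ∃ p ∈ (Λv (src e)).map D.ι, ∃ q ∈ (Λv (tgt e)).map D.ι,
          (src e = v ∧ tgt e = w ∧ g = k * D.ι (c₁ e) * p ∧ h = k * D.ι (c₂ e) * q) ∨
          (src e = w ∧ tgt e = v ∧ h = k * D.ι (c₁ e) * p ∧ g = k * D.ι (c₂ e) * q)) :
    D.ProfiniteConjugatesOfCompactSubgroups :=
  D.prop21_of_cosetTree_of_isTempered (D.isTempered_tp_of_chart c e) hRF Λv src tgt c₁ c₂
    (fun Λ hΛc _ => D.conj_le_of_compactInVerticial_at c e h𝒢 hCV Λv hΛv Λ hΛc) hA3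

/-- **[IUTchI] Proposition 2.2, "in particular, `Π^tp_𝔾` is commensurably terminal in `Π̂_𝔾`"**, for
`D` with `Π^tp_𝔾` a tempered fundamental group chart of `𝒢`, the [SemiAnbd] inputs BY NAME with Thm 3.7
(iii) AT `𝒢` (`CompactInVerticialAt 𝒢`); remaining hypotheses exactly as in the original.  φ2 twin of
`tp_isCommensurablyTerminal_of_chart`. ([IUTchI] Prop 2.2 p.45) [claim: Mochizuki2012, status: disputed] -/
theorem tp_isCommensurablyTerminal_of_chart_at [T2Space D.Hat] (c : TemperedPiChart 𝒢)
    (e : D.Tp ≃ₜ* c.G) (h𝒢 : 𝒢.Thm37Hypotheses)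
    (hCV : CompactInVerticialAt 𝒢) (hVI : VerticialInjective.{u})
    (Λv : 𝒢.graph.Vertex → Subgroup D.Tp)
    (hΛv : ∀ v, (Λv v).map (e : D.Tp →* c.G) ∈ verticialSubgroups c v)
    (hRF : ∀ U ∈ 𝓝 (1 : D.Tp), ∃ N : OpenNormalSubgroup D.Tp, (N : Set D.Tp) ⊆ U ∧
      ((N.toSubgroup.map D.ι).topologicalClosure).comap D.ι ≤ N.toSubgroup)
    {E : Type*} (src tgt : E → 𝒢.graph.Vertex) (c₁ c₂ : E → D.Tp)
    (hA3 : ∀ (v w : 𝒢.graph.Vertex) (g h : D.Hat),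
      MulAut.conj g • (Λv v).map D.ι ⊓ MulAut.conj h • (Λv w).map D.ι ≠ ⊥ →
        (v = w ∧ g⁻¹ * h ∈ (Λv v).map D.ι) ∨
        ∃ (e : E) (k : D.Hat), ∃ p ∈ (Λv (src e)).map D.ι, ∃ q ∈ (Λv (tgt e)).map D.ι,
          (src e = v ∧ tgt e = w ∧ g = k * D.ι (c₁ e) * p ∧ h = k * D.ι (c₂ e) * q) ∨
          (src e = w ∧ tgt e = v ∧ h = k * D.ι (c₁ e) * p ∧ g = k * D.ι (c₂ e) * q)) :
    IsCommensurablyTerminal D.ι.range := by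
  obtain ⟨v₀, hv₀c, hv₀inf⟩ := D.exists_infinite_compact_of_chart c e h𝒢 hVI Λv hΛv
  exact D.tp_isCommensurablyTerminal_of_cosetTree (D.isTempered_tp_of_chart c e) hRF Λv src tgt
    c₁ c₂ (fun Λ hΛc _ => D.conj_le_of_compactInVerticial_at c e h𝒢 hCV Λv hΛv Λ hΛc) hA3 v₀ hv₀c
    hv₀inf

end TemperedGraphGroupData

end Literature.IUT.HodgeTheaters
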